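import Summits.ResolutionOfSingularities.ResolutionOfSingularities.Theorems.ValuativeLuAlphaPTorsorRingEquivTransport
import Literature.AlgebraicGeometry.Resolution.DerivativeIdealsLocalization
import Literature.AlgebraicGeometry.Resolution.RegularSystemOfParameters

/-!
# Four elementary helpers for the branch `DiscreteAllDim` of the line `pfaff-line-log-final-forms`

Helper file for the crux `Valuative.LuAlphaPTorsor` (item `stmt-ResolutionOfSingularities-0641`),
line `pfaff-line-log-final-forms`, branch `DiscreteAllDim` (the crux along every discrete
rank-one valuation, every base dimension): the registered helper stubs H1–H4 of the lead's
statement file.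

* `fieldDerivation_of_subring` (H1): a `ℤ`-derivation of a subring `S ⊆ K'` whose fractions
  exhaust the field `K'` extends to a `ℤ`-derivation of `K'` (`K' = Frac S`, and derivations
  extend to localizations: `exists_derivation_extend_of_isLocalization`);
* `subringDerivation_of_field` (H2): a `ℤ`-derivation of `K'` mapping `S` into `S` restricts to
  a `ℤ`-derivation of `S`;
* `duals_of_ringEquiv_fin` (H3): the existence of dual `ℤ`-derivations of a `d`-element family
  generating exactly the non-units transports along ring isomorphisms (the `Fin d` version of
  `duals_of_ringEquiv`);
* `exists_rsop_cons` (H4): in a regular local ring `L`, every `x ∈ 𝔪 ∖ 𝔪²` is the first member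
  of a family of `dim L` generators of `𝔪` (exchange in a minimal basis of `𝔪`).
-/

set_option linter.dupNamespace false

namespace Summit.ResolutionOfSingularities.ResolutionOfSingularities.Theorems.PfaffLine

open IsLocalRing Literature.AlgebraicGeometry.Resolution

/-- **H1, derivations of a subring with the field as fraction field extend to the field.** If
every element of the field `K'` is a quotient of elements of the subring `S`, then `K'` is the
fraction field of `S` (`IsFractionRing.of_field`) and every `ℤ`-derivation `δ` of `S` extends to
a `ℤ`-derivation `D` of `K'` with `D|_S = δ` (`exists_derivation_extend_of_isLocalization`,
`δ'(a/s) = (δ(a)s - aδ(s))/s²`). [folklore] -/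
theorem fieldDerivation_of_subring :
    ∀ (K' : Type) [Field K'] (S : Subring K'), (∀ z : K', ∃ a ∈ S, ∃ b ∈ S, b ≠ 0 ∧ z = a / b) → ∀ δ : Derivation ℤ S S, ∃ D : Derivation ℤ K' K', ∀ z : S, D z = δ z := by
  intro K' _ S hS δ
  haveI : IsFractionRing S K' := IsFractionRing.of_field S K' fun z => by
    obtain ⟨a, ha, b, hb, -, rfl⟩ := hS z
    exact ⟨⟨a, ha⟩, ⟨b, hb⟩, rfl⟩
  obtain ⟨D, hD⟩ := exists_derivation_extend_of_isLocalization ℤ K' (nonZeroDivisors S) δ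
  exact ⟨D, fun z => hD z⟩

/-- **H2, derivations of the field preserving a subring restrict to the subring.** If the
`ℤ`-derivation `D` of the field `K'` maps the subring `S` into itself, then `z ↦ D z` is a
`ℤ`-derivation `δ` of `S` with `δ z = D z` in `K'`. [folklore] -/
theorem subringDerivation_of_field :
    ∀ (K' : Type) [Field K'] (S : Subring K') (D : Derivation ℤ K' K'), (∀ z : K', z ∈ S → D z ∈ S) → ∃ δ : Derivation ℤ S S, ∀ z : S, (δ z : K') = D z := by
  intro K' _ S D hD
  -- the restriction of `D` to `S`, as an additive map `S → S`
  let φ : S →+ S :=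
    { toFun := fun z => ⟨D z, hD z z.2⟩
      map_zero' := Subtype.ext (by simp)
      map_add' := fun a b => Subtype.ext (by simp) }
  have hφ : ∀ z : S, (φ z : K') = D z := fun _ => rfl
  refine ⟨Derivation.mk' φ.toIntLinearMap fun a b => Subtype.ext ?_, fun z => rfl⟩
  rw [AddMonoidHom.coe_toIntLinearMap, smul_eq_mul, smul_eq_mul, Subring.coe_add, Subring.coe_mul,
    Subring.coe_mul, hφ, hφ, hφ, Subring.coe_mul, Derivation.leibniz, smul_eq_mul, smul_eq_mul]

/-- **H3, dual derivations of a `d`-element family transport along ring isomorphisms.** If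
`e : R' ≃ L` is a ring isomorphism and every family `v : Fin d → L` generating exactly the ideal
of non-units admits dual `ℤ`-derivations `D_l (v_j) = δ_lj`, then the same holds in `R'`: the
family `e ∘ v` generates the non-units of `L` (ideals and units are preserved by `e`), and the
dual derivations obtained in `L` transport back along `e⁻¹`
(`exists_derivation_transport_ringEquiv`). The `Fin d` version of `duals_of_ringEquiv`.
[folklore] -/
theorem duals_of_ringEquiv_fin :
    ∀ {R' L : Type} [CommRing R'] [CommRing L] [Algebra ℤ R'] [Algebra ℤ L] (e : R' ≃+* L) (d : ℕ), (∀ v : Fin d → L, (∀ z : L, z ∈ Ideal.span (Set.range v) ↔ ¬ IsUnit z) → ∃ D : Fin d → Derivation ℤ L L, ∀ l j, D l (v j) = if l = j then 1 else 0) → ∀ v : Fin d → R', (∀ z : R', z ∈ Ideal.span (Set.range v) ↔ ¬ IsUnit z) → ∃ D : Fin d → Derivation ℤ R' R', ∀ l j, D l (v j) = if l = j then 1 else 0 := by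
  intro R' L _ _ _ _ e d hdual v hv
  -- push the family `v` forward to `L`: it still generates exactly the non-units
  have hv' : ∀ z : L, z ∈ Ideal.span (Set.range (⇑e ∘ v)) ↔ ¬ IsUnit z := fun z => by
    rw [Set.range_comp, ← Ideal.map_span, ← Ideal.symm_apply_mem_of_equiv_iff, hv (e.symm z),
      not_iff_not]
    constructor
    · intro hz
      rw [← e.apply_symm_apply z]
      exact hz.map e
    · intro hz
      exact hz.map e.symm
  obtain ⟨D, hD⟩ := hdual (⇑e ∘ v) hv'
  -- transport the derivations back to `R'`
  choose D' hD' using fun l => exists_derivation_transport_ringEquiv e.symm (D l)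
  refine ⟨D', fun l j => ?_⟩
  have H := hD' l (e (v j))
  rw [e.symm_apply_apply] at H
  rw [H, show D l (e (v j)) = if l = j then 1 else 0 from hD l j]
  split_ifs <;> simp

/-- **Exchange in a basis of `𝔪`.** In a local ring, if `w : Fin (d + 1) → L` generates the
maximal ideal `𝔪` and `x ∈ 𝔪 ∖ 𝔪²`, then writing `x = ∑ a_j w_j` some coefficient `a_{j₀}` is a
unit (otherwise `x ∈ 𝔪 · 𝔪`), and the family `(x, (w_j)_{j ≠ j₀})` still generates `𝔪`
(`w_{j₀} = a_{j₀}⁻¹ (x - ∑_{j ≠ j₀} a_j w_j)`). [folklore] -/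
theorem exists_cons_span_eq_maximalIdeal {L : Type*} [CommRing L] [IsLocalRing L] {d : ℕ}
    (w : Fin (d + 1) → L) (hw : Ideal.span (Set.range w) = maximalIdeal L) {x : L}
    (hx : x ∈ maximalIdeal L) (hx2 : x ∉ maximalIdeal L ^ 2) :
    ∃ j₀ : Fin (d + 1), Ideal.span (Set.range (Fin.cons x (w ∘ j₀.succAbove) : Fin (d + 1) → L)) =
      maximalIdeal L := by
  classical
  -- write `x = ∑ a j * w j`
  obtain ⟨a, ha⟩ := Ideal.mem_span_range_iff_exists_fun.mp (hw.symm ▸ hx : x ∈ Ideal.span (Set.range w))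
  -- some coefficient is a unit
  have hunit : ∃ j₀, IsUnit (a j₀) := by
    by_contra hcon
    push Not at hcon
    apply hx2
    rw [← ha, pow_two]
    refine Ideal.sum_mem _ fun j _ => Ideal.mul_mem_mul ?_ ?_
    · exact (mem_maximalIdeal _).mpr (hcon j)
    · exact hw ▸ Ideal.subset_span ⟨j, rfl⟩
  obtain ⟨j₀, hj₀⟩ := hunit
  refine ⟨j₀, le_antisymm ?_ ?_⟩
  · -- every member of the new family lies in `𝔪`
    rw [Ideal.span_le, Set.range_subset_iff]
    refine Fin.cases ?_ fun i => ?_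
    · rw [SetLike.mem_coe, Fin.cons_zero]
      exact hx
    · rw [SetLike.mem_coe, Fin.cons_succ, Function.comp_apply, ← hw]
      exact Ideal.subset_span ⟨_, rfl⟩
  · -- every `w j` lies in the span of the new family
    have hmem : ∀ i : Fin d, w (j₀.succAbove i) ∈
        Ideal.span (Set.range (Fin.cons x (w ∘ j₀.succAbove) : Fin (d + 1) → L)) := fun i =>
      Ideal.subset_span ⟨i.succ, by simp only [Fin.cons_succ, Function.comp_apply]⟩
    have hxmem : x ∈ Ideal.span (Set.range (Fin.cons x (w ∘ j₀.succAbove) : Fin (d + 1) → L)) :=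
      Ideal.subset_span ⟨0, by simp only [Fin.cons_zero]⟩
    rw [← hw, Ideal.span_le, Set.range_subset_iff]
    intro j
    by_cases hj : j = j₀
    · subst hj
      -- `a j * w j = x - ∑_{i} a (j.succAbove i) * w (j.succAbove i)`
      have hsum : a j * w j = x - Finset.univ.sum fun i => a (j.succAbove i) * w (j.succAbove i) := by
        rw [← ha, Fin.sum_univ_succAbove _ j, add_sub_cancel_right]
      rw [SetLike.mem_coe, ← Ideal.unit_mul_mem_iff_mem _ hj₀, hsum]
      exact Ideal.sub_mem _ hxmem (Ideal.sum_mem _ fun i _ => Ideal.mul_mem_left _ _ (hmem i))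
    · obtain ⟨i, rfl⟩ := Fin.exists_succAbove_eq hj
      exact hmem i

/-- **H4, an element of `𝔪 ∖ 𝔪²` is the first member of a regular system of parameters.** In a
regular local ring `L` of dimension `dim L = d + 1`, every `x ∈ 𝔪 ∖ 𝔪²` is the first member of
a family `u : Fin (d + 1) → L` generating `𝔪`: take a minimal basis `w` of `𝔪` (`dim L` elements,
`exists_regularSystemOfParameters`; `dim L ≥ 1` since `x ≠ 0` lies in `𝔪`) and exchange one
member with a unit coefficient in `x = ∑ a_j w_j` against `x`
(`exists_cons_span_eq_maximalIdeal`). [folklore] -/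
theorem exists_rsop_cons :
    ∀ {L : Type} [CommRing L] [IsRegularLocalRing L] (x : L), x ∈ IsLocalRing.maximalIdeal L → x ∉ IsLocalRing.maximalIdeal L ^ 2 → ∃ (d : ℕ) (u : Fin (d + 1) → L), u 0 = x ∧ Ideal.span (Set.range u) = IsLocalRing.maximalIdeal L ∧ ringKrullDim L = ((d + 1 : ℕ) : WithBot ℕ∞) := by
  intro L _ _ x hx hx2
  -- a regular system of parameters `w : Fin n → L`, `n = dim L`
  obtain ⟨n, w, hw, hdim⟩ : ∃ (n : ℕ) (w : Fin n → L),
      Ideal.span (Set.range w) = maximalIdeal L ∧ ringKrullDim L = (n : WithBot ℕ∞) := by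
    obtain ⟨w, hw⟩ := exists_regularSystemOfParameters (R := L)
    exact ⟨_, w, hw, (IsRegularLocalRing.spanFinrank_maximalIdeal (R := L)).symm⟩
  cases n with
  | zero =>
    -- `𝔪 = ⊥`, so `x = 0 ∈ 𝔪²`
    exfalso
    apply hx2
    have hbot : maximalIdeal L = ⊥ := by
      rw [← hw, Set.range_eq_empty, Ideal.span_empty]
    rw [hbot, Ideal.mem_bot] at hx
    rw [hx]
    exact Ideal.zero_mem _
  | succ d =>
    obtain ⟨j₀, hj₀⟩ := exists_cons_span_eq_maximalIdeal w hw hx hx2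
    exact ⟨d, Fin.cons x (w ∘ j₀.succAbove), by simp only [Fin.cons_zero], hj₀, hdim⟩

end Summit.ResolutionOfSingularities.ResolutionOfSingularities.Theorems.PfaffLine
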